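import Literature.Analysis.FluidPDE.TaoAveragedRotationAveraging
import Literature.Analysis.FluidPDE.TaoAveragedBetaForm
import Literature.Analysis.FluidPDE.TaoAveragedRhoSymbol
import Literature.Analysis.FluidPDE.TaoAveragedCascadeStepsProofs
import Literature.Analysis.FluidPDE.TaoAveragedRotationAveragingProofs
import Literature.Analysis.FluidPDE.TaoCascadeOfSingleScale
import HarnessLib

/-!
# Tao 2016, Theorem 3.2: the crux `localCascade_isComplexAverage` from the three open leaves

T. Tao, *Finite time blowup for an averaged three-dimensional Navier–Stokes equation*,
J. Amer. Math. Soc. **29** (2016), 601–674 = arXiv:1402.0290v3 (held as `paper:arxiv-1402.0290`;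
all numbers are those of that text), §3.2–§3.9, pp. 15–20.

The named fact `Literature.Analysis.FluidPDE.Tao2016.localCascade_isComplexAverage`
(`TaoAveragedComplexAverage.lean`: for `ε₀` below an absolute threshold every local cascade
operator is a complex average of the Euler bilinear operator `B` — the claim to which §3.1
reduces Theorem 3.2, "Suppose we can show that every local cascade operator `C` is a complex
average of the Euler bilinear operator `B` …", p. 15) was decomposed along the printed steps into
the six named facts of `TaoAveragedCascadeSteps.lean`, glued by
`localCascade_isComplexAverage_of_steps` (`TaoAveragedCascadeAssembly.lean`). Four of the six are
now theorems of the tree: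

* §3.3 — `betaForm_isComplexAverage_holds` (`TaoAveragedBetaForm.lean`);
* §3.2 ¶3 — `complexAverage_trans_holds` (`TaoAveragedCascadeStepsProofs.lean`);
* §3.2 ¶2 — `basicCascade_of_normalised_holds` (`TaoAveragedCascadeStepsProofs.lean`);
* §3.3, last paragraph — `betaRhoForm_isComplexAverage_holds` (`TaoAveragedRhoSymbol.lean`);

and the fifth, `singleScale_isComplexAverageNoDil` (§3.5–§3.9), is itself reduced
(`singleScale_isComplexAverageNoDil_of_steps`, `TaoAveragedRotationAveraging.lean`) to
`planeWaveSynthesis` (§3.6, last paragraph) and `rotationAverage_jointWeight` (§3.6–§3.9). This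
file records the resulting state of the reduction, proved, in one place that co-imports the four
discharges: `localCascade_isComplexAverage` — and with the §3.1 theorems, **Theorem 3.2**
(`localCascade_isAveraged`) — follow from the two remaining step facts
(`…_of_two`: `singleScale_isComplexAverageNoDil`, `cascade_of_singleScale`), equivalently from
the three open leaves (`…_of_leaves`: `planeWaveSynthesis`, `rotationAverage_jointWeight`,
`cascade_of_singleScale`). No new named fact is introduced; the discharge
`localCascade_isComplexAverage_holds` is the one-line specialisation of
`localCascade_isComplexAverage_of_two` once those leaves are theorems.

**Update (two of the three leaves discharged).** `planeWaveSynthesis` is now the theorem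
`planeWaveSynthesis_holds` (`TaoAveragedRotationAveragingProofs.lean`) and `cascade_of_singleScale`
the theorem `cascade_of_singleScale_holds` (`TaoCascadeOfSingleScale.lean`); the `…_of_jointWeight`
theorems below feed them in, so that `singleScale_isComplexAverageNoDil`,
`localCascade_isComplexAverage` and Theorem 3.2 (`localCascade_isAveraged`) each follow from the
single remaining named fact `rotationAverage_jointWeight` (§3.6 (3.14)–(3.16) with §3.7–§3.9), and
`localCascade_isComplexAverage_holds` will be `localCascade_isComplexAverage_of_jointWeight` applied
to its discharge.

## References

* T. Tao, J. Amer. Math. Soc. 29 (2016), 601–674, arXiv:1402.0290v3, §3.1 p. 15, §3.2–§3.9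
  pp. 15–20, Thm. 3.2. Key `Tao2016AveragedNS`.
-/

noncomputable section

namespace Literature.Analysis.FluidPDE.Tao2016

/-- **`localCascade_isComplexAverage` from the two remaining §3.4 / §3.5–3.9 facts** (Tao 2016,
§3.4: "Thus, to finish the proof of Theorem 3.2, it suffices to show that `C₀` is a complex
average of `B_{η,ρ,0}`", p. 17, together with the §3.4 reduction itself): the six-step glue
`localCascade_isComplexAverage_of_steps` with its §3.2–§3.3 hypotheses fed by the tree's
discharges `betaForm_isComplexAverage_holds`, `complexAverage_trans_holds`,
`basicCascade_of_normalised_holds`, `betaRhoForm_isComplexAverage_holds`. [cite: Tao2016AveragedNS, §3.2–3.4 pp. 15–17] -/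
theorem localCascade_isComplexAverage_of_two (h₁ : singleScale_isComplexAverageNoDil)
    (h₂ : cascade_of_singleScale) : localCascade_isComplexAverage :=
  localCascade_isComplexAverage_of_steps h₁ h₂ betaForm_isComplexAverage_holds
    complexAverage_trans_holds basicCascade_of_normalised_holds betaRhoForm_isComplexAverage_holds

/-- **`localCascade_isComplexAverage` from the three open leaves of its decomposition**:
plane-wave synthesis of joint weights (§3.6, last paragraph), rotation averaging with a joint
weight (§3.6 (3.15)–(3.16) with §3.7–§3.9), and the single-scale reduction (§3.4). [cite: Tao2016AveragedNS, §3.4–3.9 pp. 16–20] -/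
theorem localCascade_isComplexAverage_of_leaves (hA : planeWaveSynthesis)
    (hB : rotationAverage_jointWeight) (h₂ : cascade_of_singleScale) :
    localCascade_isComplexAverage :=
  localCascade_isComplexAverage_of_two (singleScale_isComplexAverageNoDil_of_steps hA hB) h₂

/-- **Theorem 3.2 (`localCascade_isAveraged`) from the two remaining §3.4 / §3.5–3.9 facts**:
`localCascade_isAveraged_of_steps` (the §3.1 inputs `memH10dfC_decomposition_holds`,
`complexAverage_linear_right_holds`, `complexAverage_isAveraged_holds` being theorems of the
tree) with the four discharged step facts. [cite: Tao2016AveragedNS, Thm. 3.2 and §3.1–3.4 pp. 15–17] -/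
theorem localCascade_isAveraged_of_two (h₁ : singleScale_isComplexAverageNoDil)
    (h₂ : cascade_of_singleScale) : localCascade_isAveraged :=
  localCascade_isAveraged_of_steps h₁ h₂ betaForm_isComplexAverage_holds
    complexAverage_trans_holds basicCascade_of_normalised_holds betaRhoForm_isComplexAverage_holds

/-- **Theorem 3.2 (`localCascade_isAveraged`) from the three open leaves** `planeWaveSynthesis`,
`rotationAverage_jointWeight`, `cascade_of_singleScale`. [cite: Tao2016AveragedNS, Thm. 3.2 and §3.4–3.9 pp. 16–20] -/
theorem localCascade_isAveraged_of_leaves (hA : planeWaveSynthesis)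
    (hB : rotationAverage_jointWeight) (h₂ : cascade_of_singleScale) : localCascade_isAveraged :=
  localCascade_isAveraged_of_two (singleScale_isComplexAverageNoDil_of_steps hA hB) h₂

/-! ### Two leaves discharged: everything from `rotationAverage_jointWeight` -/

/-- **§3.5–§3.9 from the rotation averaging with a joint weight alone**: the named fact
`singleScale_isComplexAverageNoDil` (for normalised profiles, `C₀` is a dilation-free complex
average (3.9) of `B_{η,ρ,0}`) follows from `rotationAverage_jointWeight` (§3.6 (3.14)–(3.16) with
§3.7–§3.9), the plane-wave synthesis of §3.6 being the theorem `planeWaveSynthesis_holds`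
("Inserting this expansion into (3.16), we obtain the desired expansion (3.15)", p. 18). [cite: Tao2016AveragedNS, §3.5–3.9 pp. 17–20] -/
theorem singleScale_isComplexAverageNoDil_of_jointWeight (hB : rotationAverage_jointWeight) :
    singleScale_isComplexAverageNoDil :=
  singleScale_isComplexAverageNoDil_of_steps planeWaveSynthesis_holds hB

/-- **`localCascade_isComplexAverage` (§3.2–§3.9: every local cascade operator is a complex
average of `B`) from the single remaining named fact `rotationAverage_jointWeight`**: the other
two leaves of its decomposition are the theorems `planeWaveSynthesis_holds` (§3.6, last
paragraph) and `cascade_of_singleScale_holds` (§3.4). [cite: Tao2016AveragedNS, §3.2–3.9 pp. 15–20] -/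
theorem localCascade_isComplexAverage_of_jointWeight (hB : rotationAverage_jointWeight) :
    localCascade_isComplexAverage :=
  localCascade_isComplexAverage_of_leaves planeWaveSynthesis_holds hB cascade_of_singleScale_holds

/-- **Theorem 3.2 (`localCascade_isAveraged`: local cascade operators are averaged Euler
operators) from the single remaining named fact `rotationAverage_jointWeight`.** [cite: Tao2016AveragedNS, Thm. 3.2 and §3.1–3.9 pp. 15–20] -/
theorem localCascade_isAveraged_of_jointWeight (hB : rotationAverage_jointWeight) :
    localCascade_isAveraged :=
  localCascade_isAveraged_of_leaves planeWaveSynthesis_holds hB cascade_of_singleScale_holds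

end Literature.Analysis.FluidPDE.Tao2016
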